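import Summits.BirchSwinnertonDyer.Rank1Residual.X11b.PrimaryInclusionLevels
import Literature.NumberTheory.EllipticCurves.WeilPairingLevelDescent
import HarnessLib

/-!
# X11b, route R1 — LEVEL SHIFTING for the (P9) argument: `E[p^{K₀}] ↪ E[p^{K₀+e}] ↠ E[p^{K₀}]`,
# their effect on `H¹` relative to `E[p^∞]`, and the descended Weil cup product over completions

HONEST FRAMING (cell `b2b-bsdres`, run/shared/lean/b2b/bsd-rank1-residual/, verbatim in every
file): the goal of the cell is to DELETE the COMBINATION-SHAPED residual classes of the
Birch–Swinnerton-Dyer formula for ALL analytic-rank `≤ 1` elliptic curves over `ℚ` — "full BSD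
formula for every rank `≤ 1` curve in class `C`" assembled STRICTLY from published theorems — so
that the rank-`≤ 1` remainder becomes exactly the CONSTRUCTION-SHAPED classes, which are TYPED
(missing-input `Prop`s), NOT attempted. This is not "finishing BSD". Sub-cell
`b2b-bsdres-multr1-p1` (X11b, route R1 = Castella 2018 Thm. A re-proved along the author's
erratum); a RESEARCH ROUTE; no claim beyond the stated class; X11b stays CONSTRUCTION-SHAPED;
nothing here changes a label; no named fact is minted (definitions with bodies — two level maps,
a root, a descended pairing hom and its `ContPairing` — and theorems; no `sorry`).

## What is here (JSW17 proof of Prop. 3.3.2, the passage `M[p^{K₀}] ⊂ M[p^N]`; Milne ADT I §6)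

For the finite-level Poitou–Tate argument behind atom (P9) (`AcSelmer.LevelLiftingAt`,
`LocSurjFromLevels`) one compares the two levels `d = p^{K₀}` (the exponent killing the prescribed
local classes) and `n = p^{K₀+e}` (the Poitou–Tate level, `p^e` killing a finite Selmer group),
both LITERAL prime powers so that the tree's `primaryInclusion W p k : E[p^k] ↪ E[p^∞]` applies at
either level:

* `Levels.levelIncl W p K₀ e : E[p^{K₀}] →ⁱL E[p^{K₀+e}]` (the tree's `torsionInclusion`) and
  `Levels.levelMul W p K₀ e : E[p^{K₀+e}] →ⁱL E[p^{K₀}]`, `T ↦ p^e T`; `ι (π T) = p^e T`; `π` onto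
  (divisibility of `E(F̄)`), `eRoot` a `p^e`-th root;
* compatibility with `E[p^∞]`: `ι_{K₀+e} ∘ ι = ι_{K₀}` and `ι_{K₀} ∘ π = p^e · ι_{K₀+e}`, on points
  and on `H¹` over the base field AND over every extension field (completions):
  `map_primaryInclusion_map_levelIncl(_restrictField)`,
  `map_primaryInclusion_map_levelMul(_restrictField)` — from two generic functoriality lemmas
  `map_map_eq_map_of_comp_eq`, `map_map_eq_nsmul_map_of_comp_eq` (cocycle level);
* the DESCENDED pairing `E[p^{K₀}] × E[p^{K₀}] → μ_n`, `(S, T) ↦ e_n(ι S, T̃)` (`p^e T̃ = T`), of a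
  biadditive Galois-equivariant `μ_n`-valued `e` on `E[n]` (Silverman III.8.1(e) used as a
  definition, exactly as the tree's `WeilPairingLevelDescent` does for the levels `d ∣ kd`; here for
  literal prime-power levels): `descendHom`, well defined (`weilPairingHom_levelIncl_eRoot_eq`),
  equivariant (`descendHom_smul`), `descendPairing`;
* **the restricted cup-product identity over any extension field `E`** (a completion `K_v`):
  `ι_* x ∪_{e,E} ỹ = x ∪_{desc,E} (π_* ỹ)` (`cupProduct_restrict_weil_map_levelIncl_eq_descend`, one
  application of the tree's `ContPairing.cupProduct_adjoint`), hence `= 0` when `π_* ỹ = 0`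
  (`cupProduct_restrict_weil_map_levelIncl_eq_zero`) — the identity
  `⟨ι s_w, ỹ_w⟩_{p^N} = ⟨s_w, p^e ỹ_w⟩ = 0` that makes the Poitou–Tate obstruction of (P9) vanish.

References: [JetchevSkinnerWan2017] Prop. 3.3.2; [SilvermanAEC2009] Prop. III.8.1(e);
[MilneADT2006] I §6, proof of Prop. 6.9; [GreenbergLNM1716] §5, proof of Prop. 5.8.
-/

noncomputable section

open scoped Classical

open CategoryTheory Field
open Literature.NumberTheory.EllipticCurves
open Literature.NumberTheory.GaloisRepresentations
open Literature.NumberTheory.GaloisRepresentations.DiscreteGaloisModule (mu MuCarrier pairing)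
open scoped ContRepresentation

universe u

-- Cup products need `LocallyCompactSpace Γ_F`: compactness of `Γ_F` as a local instance only.
attribute [local instance] absoluteGaloisGroup_compactSpace

namespace Summit.BirchSwinnertonDyer.Rank1Residual.X11b.Levels

/-! ## §1. Two generic functoriality lemmas for `H¹(F, ·)` on intertwining maps -/

section Functoriality

variable {F : Type u} [Field F] {M₁ M₂ M₃ : Type u}
  [AddCommGroup M₁] [TopologicalSpace M₁] [DiscreteTopology M₁]
  [AddCommGroup M₂] [TopologicalSpace M₂] [DiscreteTopology M₂]
  [AddCommGroup M₃] [TopologicalSpace M₃] [DiscreteTopology M₃]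
  {ρ₁ : DiscreteGaloisModule F M₁} {ρ₂ : DiscreteGaloisModule F M₂} {ρ₃ : DiscreteGaloisModule F M₃}

/-- **`H¹(g) ∘ H¹(f) = H¹(h)` when `g ∘ f = h` pointwise** (functoriality of `H¹(F, ·)` in the
coefficients, on classes of continuous crossed homomorphisms). Serre, *Galois Cohomology*, I.§2.2.
[folklore] -/
theorem map_map_eq_map_of_comp_eq (f : ρ₁.toContRepresentation →ⁱL ρ₂.toContRepresentation)
    (g : ρ₂.toContRepresentation →ⁱL ρ₃.toContRepresentation)
    (h : ρ₁.toContRepresentation →ⁱL ρ₃.toContRepresentation) (hcomp : ∀ a : M₁, g (f a) = h a)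
    (x : galoisCohomology ρ₁ 1) :
    galoisCohomology.map g 1 (galoisCohomology.map f 1 x) = galoisCohomology.map h 1 x := by
  obtain ⟨φ, rfl⟩ := oneCocycleClass_surjective _ x
  rw [galoisCohomology.map_one_oneCocycleClass, galoisCohomology.map_one_oneCocycleClass,
    galoisCohomology.map_one_oneCocycleClass]
  exact congrArg (oneCocycleClass _) (Subtype.ext (ContinuousMap.ext fun σ ↦ hcomp (φ.1 σ)))

/-- **`H¹(h) ∘ H¹(g) = m · H¹(i)` when `h ∘ g = m · i` pointwise.** Serre, *Galois Cohomology*,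
I.§2.2. [folklore] -/
theorem map_map_eq_nsmul_map_of_comp_eq (g : ρ₂.toContRepresentation →ⁱL ρ₁.toContRepresentation)
    (h : ρ₁.toContRepresentation →ⁱL ρ₃.toContRepresentation)
    (i : ρ₂.toContRepresentation →ⁱL ρ₃.toContRepresentation) (m : ℕ)
    (hcomp : ∀ b : M₂, h (g b) = m • i b) (y : galoisCohomology ρ₂ 1) :
    galoisCohomology.map h 1 (galoisCohomology.map g 1 y) = m • galoisCohomology.map i 1 y := by
  obtain ⟨ψ, rfl⟩ := oneCocycleClass_surjective _ y
  have hs := oneCocycleClass_smul ρ₂.toTopRep (m : ℤ) ψ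
  conv at hs => rhs; rw [Nat.cast_smul_eq_nsmul]
  have hs' : (m • oneCocycleClass ρ₂.toTopRep ψ : galoisCohomology ρ₂ 1) =
      oneCocycleClass ρ₂.toTopRep ((m : ℤ) • ψ) := hs.symm
  rw [← map_nsmul]
  refine Eq.trans ?_ (congrArg (galoisCohomology.map i 1) hs').symm
  rw [galoisCohomology.map_one_oneCocycleClass, galoisCohomology.map_one_oneCocycleClass,
    galoisCohomology.map_one_oneCocycleClass]
  refine congrArg (oneCocycleClass _) (Subtype.ext (ContinuousMap.ext fun σ ↦ ?_))
  change h (g (ψ.1 σ)) = i ((m : ℤ) • ψ.1 σ)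
  rw [hcomp, map_zsmul, natCast_zsmul]

end Functoriality

/-! ## §2. The level maps `ι : E[p^{K₀}] ↪ E[p^{K₀+e}]` and `π = [p^e] : E[p^{K₀+e}] ↠ E[p^{K₀}]` -/

section LevelMaps

variable {F : Type u} [Field F] (W : WeierstrassCurve F) (p K₀ e : ℕ)

/-- **The inclusion `ι : E[p^{K₀}] ↪ E[p^{K₀+e}]`** (the tree's `torsionInclusion`, at literal
prime-power levels). [folklore] -/
def levelIncl : (W.torsionGaloisModule ((p ^ K₀ : ℕ) : ℤ)).toContRepresentation →ⁱL
    (W.torsionGaloisModule ((p ^ (K₀ + e) : ℕ) : ℤ)).toContRepresentation :=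
  W.torsionInclusion (Int.natCast_dvd_natCast.mpr (Nat.pow_dvd_pow p (Nat.le_add_right K₀ e)))

/-- `ι` on underlying points is the identity. [folklore] -/
@[simp]
theorem coe_levelIncl_apply (S : W.geomTorsion ((p ^ K₀ : ℕ) : ℤ)) :
    ((levelIncl W p K₀ e S : W.geomTorsion ((p ^ (K₀ + e) : ℕ) : ℤ)) : W.geomPoints) = S :=
  rfl

/-- `p^e T ∈ E[p^{K₀}]` for `T ∈ E[p^{K₀+e}]`. [folklore] -/
theorem zsmul_mem_geomTorsion_pow (T : W.geomTorsion ((p ^ (K₀ + e) : ℕ) : ℤ)) :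
    ((p ^ e : ℕ) : ℤ) • (T : W.geomPoints) ∈ W.geomTorsion ((p ^ K₀ : ℕ) : ℤ) := by
  rw [W.mem_geomTorsion_iff, smul_smul, ← Nat.cast_mul, ← pow_add]
  exact (W.mem_geomTorsion_iff _ _).mp T.2

/-- **Multiplication by `p^e`, `π : E[p^{K₀+e}] → E[p^{K₀}]`**, as a continuous `Γ_F`-intertwining
map (cf. the tree's `torsionMulBy`, at literal prime-power levels). [folklore] -/
def levelMul : (W.torsionGaloisModule ((p ^ (K₀ + e) : ℕ) : ℤ)).toContRepresentation →ⁱL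
    (W.torsionGaloisModule ((p ^ K₀ : ℕ) : ℤ)).toContRepresentation where
  toContinuousLinearMap :=
    ⟨(((zsmulAddGroupHom (α := W.geomPoints) ((p ^ e : ℕ) : ℤ)).comp
        (W.geomTorsion ((p ^ (K₀ + e) : ℕ) : ℤ)).subtype).codRestrict
          (W.geomTorsion ((p ^ K₀ : ℕ) : ℤ)) fun T ↦ zsmul_mem_geomTorsion_pow W p K₀ e T).toIntLinearMap,
      continuous_of_discreteTopology⟩
  isIntertwining' σ := by
    ext T
    change ((p ^ e : ℕ) : ℤ) • ((σ • T : W.geomTorsion ((p ^ (K₀ + e) : ℕ) : ℤ)) : W.geomPoints) =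
      σ • (((p ^ e : ℕ) : ℤ) • (T : W.geomPoints))
    rw [Literature.NumberTheory.EllipticCurves.AddSubgroup.torsionBy.coe_smul,
      W.smul_zsmul_geomPoints]

/-- `π` on underlying points: `T ↦ p^e • T`. [folklore] -/
@[simp]
theorem coe_levelMul_apply (T : W.geomTorsion ((p ^ (K₀ + e) : ℕ) : ℤ)) :
    ((levelMul W p K₀ e T : W.geomTorsion ((p ^ K₀ : ℕ) : ℤ)) : W.geomPoints) =
      ((p ^ e : ℕ) : ℤ) • (T : W.geomPoints) :=
  rfl

/-- `ι (π T) = p^e • T`. [folklore] -/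
theorem levelIncl_levelMul (T : W.geomTorsion ((p ^ (K₀ + e) : ℕ) : ℤ)) :
    levelIncl W p K₀ e (levelMul W p K₀ e T) = p ^ e • T := by
  apply Subtype.ext
  rw [coe_levelIncl_apply, coe_levelMul_apply, AddSubmonoidClass.coe_nsmul, natCast_zsmul]

/-- `π` commutes with the Galois action. [folklore] -/
theorem levelMul_smul (σ : absoluteGaloisGroup F) (T : W.geomTorsion ((p ^ (K₀ + e) : ℕ) : ℤ)) :
    levelMul W p K₀ e (σ • T) = σ • levelMul W p K₀ e T :=
  Subtype.ext (W.smul_zsmul_geomPoints ((p ^ e : ℕ) : ℤ) σ (T : W.geomPoints)).symm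

/-- **`π` is onto** (divisibility of `E(F̄)`: a `p^e`-th root of a point of `E[p^{K₀}]` lies in
`E[p^{K₀+e}]`). [folklore] -/
theorem levelMul_surjective [Fact p.Prime] (hdiv : W.zsmul_geomPoints_surjective) [W.IsElliptic] :
    Function.Surjective (levelMul W p K₀ e) := by
  intro T
  have hne : ((p ^ e : ℕ) : ℤ) ≠ 0 := by exact_mod_cast pow_ne_zero e (Fact.out : p.Prime).ne_zero
  obtain ⟨Q, hQ⟩ := hdiv hne (T : W.geomPoints)
  have hQ' : ((p ^ e : ℕ) : ℤ) • Q = T := hQ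
  have hQmem : Q ∈ W.geomTorsion ((p ^ (K₀ + e) : ℕ) : ℤ) := by
    rw [W.mem_geomTorsion_iff, pow_add, Nat.cast_mul, mul_smul, hQ']
    exact (W.mem_geomTorsion_iff _ _).mp T.2
  exact ⟨⟨Q, hQmem⟩, Subtype.ext hQ'⟩

/-- **A `p^e`-th root in `E[p^{K₀+e}]`** of `T ∈ E[p^{K₀}]`: `π (eRoot T) = T`. [folklore] -/
def eRoot [Fact p.Prime] (hdiv : W.zsmul_geomPoints_surjective) [W.IsElliptic]
    (T : W.geomTorsion ((p ^ K₀ : ℕ) : ℤ)) : W.geomTorsion ((p ^ (K₀ + e) : ℕ) : ℤ) :=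
  (levelMul_surjective W p K₀ e hdiv T).choose

/-- `π (eRoot T) = T`. [folklore] -/
@[simp]
theorem levelMul_eRoot [Fact p.Prime] (hdiv : W.zsmul_geomPoints_surjective) [W.IsElliptic]
    (T : W.geomTorsion ((p ^ K₀ : ℕ) : ℤ)) : levelMul W p K₀ e (eRoot W p K₀ e hdiv T) = T :=
  (levelMul_surjective W p K₀ e hdiv T).choose_spec

/-- `ι T = p^e • eRoot T`. [folklore] -/
theorem levelIncl_eq_nsmul_eRoot [Fact p.Prime] (hdiv : W.zsmul_geomPoints_surjective)
    [W.IsElliptic] (T : W.geomTorsion ((p ^ K₀ : ℕ) : ℤ)) :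
    levelIncl W p K₀ e T = p ^ e • eRoot W p K₀ e hdiv T := by
  rw [← levelIncl_levelMul, levelMul_eRoot]

/-- Two `p^e`-th roots of the same point differ by an element killed by `p^e`. [folklore] -/
theorem nsmul_eRoot_sub [Fact p.Prime] (hdiv : W.zsmul_geomPoints_surjective) [W.IsElliptic]
    (T : W.geomTorsion ((p ^ K₀ : ℕ) : ℤ)) (T' : W.geomTorsion ((p ^ (K₀ + e) : ℕ) : ℤ))
    (hT' : levelMul W p K₀ e T' = T) : p ^ e • (eRoot W p K₀ e hdiv T - T') = 0 := by
  rw [nsmul_sub, ← levelIncl_levelMul, ← levelIncl_levelMul, levelMul_eRoot, hT', sub_self]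

/-! ### Compatibility with `E[p^∞]`: `ι_{K₀+e} ∘ ι = ι_{K₀}` and `ι_{K₀} ∘ π = p^e · ι_{K₀+e}` -/

/-- `ι_{K₀+e} (ι S) = ι_{K₀} S` in `E[p^∞]`. [folklore] -/
theorem primaryInclusion_levelIncl (S : W.geomTorsion ((p ^ K₀ : ℕ) : ℤ)) :
    primaryInclusion W p (K₀ + e) (levelIncl W p K₀ e S) = primaryInclusion W p K₀ S :=
  Subtype.ext rfl

/-- `ι_{K₀} (π T) = p^e • ι_{K₀+e} T` in `E[p^∞]`. [folklore] -/
theorem primaryInclusion_levelMul (T : W.geomTorsion ((p ^ (K₀ + e) : ℕ) : ℤ)) :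
    primaryInclusion W p K₀ (levelMul W p K₀ e T) = p ^ e • primaryInclusion W p (K₀ + e) T := by
  apply Subtype.ext
  rw [coe_primaryInclusion_apply, coe_levelMul_apply, AddSubmonoidClass.coe_nsmul,
    coe_primaryInclusion_apply, natCast_zsmul]

/-- **On `H¹` over the base field: `H¹(ι_{K₀+e}) ∘ H¹(ι) = H¹(ι_{K₀})`.**
[cite: GreenbergLNM1716, §5 proof of Prop. 5.8] -/
theorem map_primaryInclusion_map_levelIncl
    (x : galoisCohomology (W.torsionGaloisModule ((p ^ K₀ : ℕ) : ℤ)) 1) :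
    galoisCohomology.map (primaryInclusion W p (K₀ + e)) 1
        (galoisCohomology.map (levelIncl W p K₀ e) 1 x) =
      galoisCohomology.map (primaryInclusion W p K₀) 1 x :=
  map_map_eq_map_of_comp_eq _ _ _ (primaryInclusion_levelIncl W p K₀ e) x

/-- **On `H¹` over the base field: `H¹(ι_{K₀}) ∘ H¹(π) = p^e · H¹(ι_{K₀+e})`.**
[cite: GreenbergLNM1716, §5 proof of Prop. 5.8] -/
theorem map_primaryInclusion_map_levelMul
    (y : galoisCohomology (W.torsionGaloisModule ((p ^ (K₀ + e) : ℕ) : ℤ)) 1) :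
    galoisCohomology.map (primaryInclusion W p K₀) 1
        (galoisCohomology.map (levelMul W p K₀ e) 1 y) =
      p ^ e • galoisCohomology.map (primaryInclusion W p (K₀ + e)) 1 y :=
  map_map_eq_nsmul_map_of_comp_eq _ _ _ (p ^ e) (primaryInclusion_levelMul W p K₀ e) y

variable (E : Type u) [Field E] [Algebra F E]

/-- **Over an extension field `E` (a completion): `H¹(ι_{K₀+e}|_E) ∘ H¹(ι|_E) = H¹(ι_{K₀}|_E)`.**
[cite: GreenbergLNM1716, §5 proof of Prop. 5.8] -/
theorem map_primaryInclusion_map_levelIncl_restrictField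
    (x : galoisCohomology (GaloisRep.restrictField E (W.torsionGaloisModule ((p ^ K₀ : ℕ) : ℤ))) 1) :
    galoisCohomology.map ((primaryInclusion W p (K₀ + e)).restrictField E) 1
        (galoisCohomology.map ((levelIncl W p K₀ e).restrictField E) 1 x) =
      galoisCohomology.map ((primaryInclusion W p K₀).restrictField E) 1 x :=
  map_map_eq_map_of_comp_eq (ρ₁ := GaloisRep.restrictField E (W.torsionGaloisModule ((p ^ K₀ : ℕ) : ℤ)))
    (ρ₂ := GaloisRep.restrictField E (W.torsionGaloisModule ((p ^ (K₀ + e) : ℕ) : ℤ)))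
    (ρ₃ := GaloisRep.restrictField E (LocBridge.primaryGaloisModule W p))
    _ _ _ (primaryInclusion_levelIncl W p K₀ e) x

/-- **Over an extension field `E`: `H¹(ι_{K₀}|_E) ∘ H¹(π|_E) = p^e · H¹(ι_{K₀+e}|_E)`.**
[cite: GreenbergLNM1716, §5 proof of Prop. 5.8] -/
theorem map_primaryInclusion_map_levelMul_restrictField
    (y : galoisCohomology
      (GaloisRep.restrictField E (W.torsionGaloisModule ((p ^ (K₀ + e) : ℕ) : ℤ))) 1) :
    galoisCohomology.map ((primaryInclusion W p K₀).restrictField E) 1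
        (galoisCohomology.map ((levelMul W p K₀ e).restrictField E) 1 y) =
      p ^ e • galoisCohomology.map ((primaryInclusion W p (K₀ + e)).restrictField E) 1 y :=
  map_map_eq_nsmul_map_of_comp_eq
    (ρ₂ := GaloisRep.restrictField E (W.torsionGaloisModule ((p ^ (K₀ + e) : ℕ) : ℤ)))
    (ρ₁ := GaloisRep.restrictField E (W.torsionGaloisModule ((p ^ K₀ : ℕ) : ℤ)))
    (ρ₃ := GaloisRep.restrictField E (LocBridge.primaryGaloisModule W p))
    _ _ _ (p ^ e) (primaryInclusion_levelMul W p K₀ e) y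

end LevelMaps

/-! ## §3. The descended pairing `E[p^{K₀}] × E[p^{K₀}] → μ_{p^{K₀+e}}` of a pairing `e` on `E[p^{K₀+e}]` -/

section Descend

variable {F : Type u} [Field F] (W : WeierstrassCurve F) (p K₀ e : ℕ) [Fact p.Prime] [W.IsElliptic]
  (hdiv : W.zsmul_geomPoints_surjective)

/-- `p^k ≠ 0` for a prime `p` (instance form, local to this file). [folklore] -/
theorem neZero_pow (k : ℕ) : NeZero (p ^ k) := ⟨pow_ne_zero k (Fact.out : p.Prime).ne_zero⟩

attribute [local instance] neZero_pow

variable (ε : W.geomTorsion ((p ^ (K₀ + e) : ℕ) : ℤ) → W.geomTorsion ((p ^ (K₀ + e) : ℕ) : ℤ) →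
    AlgebraicClosure F)
  (hμ : ∀ S T, ε S T ^ (p ^ (K₀ + e)) = 1)
  (hadd₁ : ∀ S₁ S₂ T, ε (S₁ + S₂) T = ε S₁ T * ε S₂ T)
  (hadd₂ : ∀ S T₁ T₂, ε S (T₁ + T₂) = ε S T₁ * ε S T₂)

include hdiv in
/-- The level-`p^{K₀+e}` pairing hom `w = weilPairingHom W (p^{K₀+e}) ε` kills `ι(E[p^{K₀}]) × E[p^{K₀+e}][p^e]`:
`w(ι S, U) = 0` if `p^e U = 0` (write `ι S = p^e S̃`; then `w(p^e S̃, U) = w(S̃, p^e U) = 0`).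
[cite: SilvermanAEC2009, Prop. III.8.1(e)] -/
theorem weilPairingHom_levelIncl_eq_zero_of_nsmul_eq_zero (S : W.geomTorsion ((p ^ K₀ : ℕ) : ℤ))
    (U : W.geomTorsion ((p ^ (K₀ + e) : ℕ) : ℤ)) (hU : p ^ e • U = 0) :
    weilPairingHom W (p ^ (K₀ + e)) ε hμ hadd₁ hadd₂ (levelIncl W p K₀ e S) U = 0 := by
  rw [levelIncl_eq_nsmul_eRoot W p K₀ e hdiv]
  change (weilPairingHom W (p ^ (K₀ + e)) ε hμ hadd₁ hadd₂).flip U (p ^ e • eRoot W p K₀ e hdiv S) = 0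
  rw [map_nsmul, AddMonoidHom.flip_apply, ← map_nsmul, hU, map_zero]

/-- **Well-definedness**: `w(ι S, T̃)` does not depend on the `p^e`-th root `T̃` of `T`.
[cite: SilvermanAEC2009, Prop. III.8.1(e)] -/
theorem weilPairingHom_levelIncl_eRoot_eq (S : W.geomTorsion ((p ^ K₀ : ℕ) : ℤ))
    {T : W.geomTorsion ((p ^ K₀ : ℕ) : ℤ)} (T' : W.geomTorsion ((p ^ (K₀ + e) : ℕ) : ℤ))
    (hT' : levelMul W p K₀ e T' = T) :
    weilPairingHom W (p ^ (K₀ + e)) ε hμ hadd₁ hadd₂ (levelIncl W p K₀ e S) (eRoot W p K₀ e hdiv T) =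
      weilPairingHom W (p ^ (K₀ + e)) ε hμ hadd₁ hadd₂ (levelIncl W p K₀ e S) T' := by
  rw [← sub_eq_zero, ← map_sub]
  exact weilPairingHom_levelIncl_eq_zero_of_nsmul_eq_zero W p K₀ e hdiv ε hμ hadd₁ hadd₂ S _
    (nsmul_eRoot_sub W p K₀ e hdiv T T' hT')

/-- **The descended pairing hom** `E[p^{K₀}] × E[p^{K₀}] → μ_{p^{K₀+e}}`, `(S, T) ↦ e(ι S, T̃)` for any
`T̃` with `p^e T̃ = T` (Silverman III.8.1(e) used as a DEFINITION; values kept in `μ_{p^{K₀+e}}`).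
[cite: SilvermanAEC2009, Prop. III.8.1(e)] -/
def descendHom : W.geomTorsion ((p ^ K₀ : ℕ) : ℤ) →+ W.geomTorsion ((p ^ K₀ : ℕ) : ℤ) →+
    MuCarrier F (p ^ (K₀ + e)) :=
  AddMonoidHom.mk' (fun S ↦ AddMonoidHom.mk'
      (fun T ↦ weilPairingHom W (p ^ (K₀ + e)) ε hμ hadd₁ hadd₂ (levelIncl W p K₀ e S)
        (eRoot W p K₀ e hdiv T))
      fun T₁ T₂ ↦ by
        rw [weilPairingHom_levelIncl_eRoot_eq W p K₀ e hdiv ε hμ hadd₁ hadd₂ S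
          (eRoot W p K₀ e hdiv T₁ + eRoot W p K₀ e hdiv T₂)
          (by rw [map_add, levelMul_eRoot, levelMul_eRoot]), map_add])
    fun S₁ S₂ ↦ by
      ext T
      simp only [AddMonoidHom.mk'_apply, AddMonoidHom.add_apply, map_add]

/-- Unfolding `descendHom` with an arbitrary root: `descendHom S T = w(ι S, T̃)` whenever
`p^e T̃ = T`. [folklore] -/
theorem descendHom_apply_eq (S T : W.geomTorsion ((p ^ K₀ : ℕ) : ℤ))
    (T' : W.geomTorsion ((p ^ (K₀ + e) : ℕ) : ℤ)) (hT' : levelMul W p K₀ e T' = T) :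
    descendHom W p K₀ e hdiv ε hμ hadd₁ hadd₂ S T =
      weilPairingHom W (p ^ (K₀ + e)) ε hμ hadd₁ hadd₂ (levelIncl W p K₀ e S) T' :=
  weilPairingHom_levelIncl_eRoot_eq W p K₀ e hdiv ε hμ hadd₁ hadd₂ S T' hT'

variable (hgal : ∀ (σ : absoluteGaloisGroup F) (S T : W.geomTorsion ((p ^ (K₀ + e) : ℕ) : ℤ)),
  σ • ε S T = ε (σ • S) (σ • T))

include hgal in
/-- **The descended pairing is `Γ_F`-equivariant.** [folklore] -/
theorem descendHom_smul (σ : absoluteGaloisGroup F) (S T : W.geomTorsion ((p ^ K₀ : ℕ) : ℤ)) :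
    descendHom W p K₀ e hdiv ε hμ hadd₁ hadd₂ (σ • S) (σ • T) =
      mu F (p ^ (K₀ + e)) σ (descendHom W p K₀ e hdiv ε hμ hadd₁ hadd₂ S T) := by
  rw [descendHom_apply_eq W p K₀ e hdiv ε hμ hadd₁ hadd₂ (σ • S) (σ • T)
    (σ • eRoot W p K₀ e hdiv T) (by rw [levelMul_smul, levelMul_eRoot])]
  exact (weilContPairing W (p ^ (K₀ + e)) ε hμ hadd₁ hadd₂ hgal).toLin_smul σ
    (levelIncl W p K₀ e S) (eRoot W p K₀ e hdiv T)

/-- **The descended pairing as a `ContPairing`** `E[p^{K₀}] × E[p^{K₀}] → μ_{p^{K₀+e}}` of discrete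
`Γ_F`-modules (input of the tree's cup product). [folklore] -/
def descendPairing :
    ContPairing (W.torsionGaloisModule ((p ^ K₀ : ℕ) : ℤ)).toTopRep
      (W.torsionGaloisModule ((p ^ K₀ : ℕ) : ℤ)).toTopRep (mu F (p ^ (K₀ + e))).toTopRep :=
  pairing (W.torsionGaloisModule ((p ^ K₀ : ℕ) : ℤ)) (W.torsionGaloisModule ((p ^ K₀ : ℕ) : ℤ))
    (mu F (p ^ (K₀ + e))) (descendHom W p K₀ e hdiv ε hμ hadd₁ hadd₂)
    fun σ S T ↦ descendHom_smul W p K₀ e hdiv ε hμ hadd₁ hadd₂ hgal σ S T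

/-! ### The restricted cup-product identity over an extension field (a completion) -/

variable (E : Type u) [Field E] [Algebra F E]

/-- **`ι_* x ∪_{e,E} ỹ = x ∪_{desc,E} (π_* ỹ)` over an extension field `E` of `F`** (restrictions
of `weilContPairing W (p^{K₀+e}) ε` and of `descendPairing` to `Γ_E`, level maps restricted to `Γ_E`):
one application of the tree's `ContPairing.cupProduct_adjoint` with `w(ι S, T̃) = descendHom S (π T̃)`.
This is the identity `⟨ι c, b'⟩_{p^N} = ⟨c, p^e b'⟩` of Milne's and JSW's level comparisons.
[cite: MilneADT2006, Ch. I §6, proof of Prop. 6.9] [cite: JetchevSkinnerWan2017, Prop. 3.3.2 (arXiv:1512.06894 p. 11)] -/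
theorem cupProduct_restrict_weil_map_levelIncl_eq_descend
    (x : galoisCohomology (GaloisRep.restrictField E (W.torsionGaloisModule ((p ^ K₀ : ℕ) : ℤ))) 1)
    (y : galoisCohomology
      (GaloisRep.restrictField E (W.torsionGaloisModule ((p ^ (K₀ + e) : ℕ) : ℤ))) 1) :
    ((weilContPairing W (p ^ (K₀ + e)) ε hμ hadd₁ hadd₂ hgal).restrict
        (absGaloisRestrict F E)).cupProduct
        (galoisCohomology.map ((levelIncl W p K₀ e).restrictField E) 1 x) y =
      ((descendPairing W p K₀ e hdiv ε hμ hadd₁ hadd₂ hgal).restrict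
        (absGaloisRestrict F E)).cupProduct x
        (galoisCohomology.map ((levelMul W p K₀ e).restrictField E) 1 y) :=
  ContPairing.cupProduct_adjoint
    ((descendPairing W p K₀ e hdiv ε hμ hadd₁ hadd₂ hgal).restrict (absGaloisRestrict F E))
    ((weilContPairing W (p ^ (K₀ + e)) ε hμ hadd₁ hadd₂ hgal).restrict (absGaloisRestrict F E))
    (DiscreteGaloisModule.homOfIntertwining ((levelIncl W p K₀ e).restrictField E))
    (DiscreteGaloisModule.homOfIntertwining ((levelMul W p K₀ e).restrictField E))
    (fun S T ↦ (descendHom_apply_eq W p K₀ e hdiv ε hμ hadd₁ hadd₂ S (levelMul W p K₀ e T) T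
      rfl).symm) x y

include hdiv in
/-- Hence **`ι_* x ∪_{e,E} ỹ = 0` over `E` whenever `π_* ỹ = 0`**. [cite: MilneADT2006, Ch. I §6, proof of Prop. 6.9] -/
theorem cupProduct_restrict_weil_map_levelIncl_eq_zero
    (x : galoisCohomology (GaloisRep.restrictField E (W.torsionGaloisModule ((p ^ K₀ : ℕ) : ℤ))) 1)
    {y : galoisCohomology
      (GaloisRep.restrictField E (W.torsionGaloisModule ((p ^ (K₀ + e) : ℕ) : ℤ))) 1}
    (hy : galoisCohomology.map ((levelMul W p K₀ e).restrictField E) 1 y = 0) :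
    ((weilContPairing W (p ^ (K₀ + e)) ε hμ hadd₁ hadd₂ hgal).restrict
        (absGaloisRestrict F E)).cupProduct
        (galoisCohomology.map ((levelIncl W p K₀ e).restrictField E) 1 x) y = 0 := by
  rw [cupProduct_restrict_weil_map_levelIncl_eq_descend W p K₀ e hdiv, hy]
  exact map_zero _

end Descend

end Summit.BirchSwinnertonDyer.Rank1Residual.X11b.Levels

end
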